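import Literature.Probability.Percolation.QuadCrossingContinuityOfLemma51
import Literature.Probability.Percolation.QuadCrossingQuadTopology
import Literature.Topology.PlaneTopology.RectangleDuality
import HarnessLib

/-!
# Open longitudinal crossing versus closed dual transversal path in one quad:
# stub `stub_kernel_quadCrossingExclusion` (line `hitting-tournament`, crux `LagHandOff`,
# stmt-CriticalPhenomena-10268)

Helper for crux stmt-CriticalPhenomena-10268 (`LagHandOff`, line `hitting-tournament`), registered
stub `stub_kernel_quadCrossingExclusion` (M3) — the third piece of the "no-mushroom" inclusion
behind the kernel stubs: in ONE quad `Q`, an OPEN drawn longitudinal crossing (a compact connected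
`K ⊆ [Q]` inside the drawn open edges `openEdgeUnion δ ω`, meeting `∂₀Q` and `∂₂Q`) and a CLOSED
transversal path (a path in `[Q]` from `∂₁Q` to `∂₃Q` drawn on the true dual lattice, i.e. inside
`openEdgeUnion δ (dualConfig ω) + δ(1+i)/2`) cannot coexist.

Proof.
1. DISJOINTNESS (`KernelQuadExclusion.shift_ne_of_mem_openEdgeUnion`): a point on a drawn open
   primal edge `[δu, δ(u + eᵢ)]` (`{u, u + eᵢ} ∈ ω`) lies on a line `re = kδ` or `im = kδ`, a point
   on a shifted drawn dual edge `[δf, δ(f + eⱼ)] + δ(1+i)/2` (`{f, f + eⱼ} ∈ dualConfig ω`) on a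
   line `re = (k + ½)δ` or `im = (k + ½)δ`; parallel ones are disjoint (integer versus
   half-integer level) and perpendicular ones meet only at the common midpoint, which forces
   `{f, f + eⱼ} = dualEdge {u, u + eᵢ}` (`dualEdge_horizontal`, `dualEdge_vertical`: faces are
   indexed by their lower-left corner), contradicting `{f, f + eⱼ} ∈ dualConfig ω =
   E(ℤ²) ∖ dualEdge '' ω` (`mem_dualConfig_iff`).
2. TOPOLOGY: the crossing lemma for a quad, `Quad.exists_mem_of_isPreconnected_crossing`
   (`QuadCrossingQuadTopology.lean`, transport of the rectangle lemma of
   `PlaneTopology/RectangleDuality.lean` by the Schoenflies straightening of `Q`): the continuum `K`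
   from `∂₀Q` to `∂₂Q` meets the path `γ.extend` from `∂₁Q` to `∂₃Q`; the common point lies in
   `openEdgeUnion δ ω` and in the shifted dual drawing, contradicting 1.

References: O. Schramm, S. Smirnov, *On the scaling limits of planar percolation*, Ann. Probab. 39
(2011), §1.3 and proof of Lemma 6.1 [SchrammSmirnov2011]; G. Grimmett, *Percolation*, 2nd ed.
(1999), §11.2 (planar duality) [GrimmettPercolation1999].
-/

noncomputable section

open Set
open scoped unitInterval
open Literature.Probability.Percolation Literature.Probability.LatticeModels
open Literature.Probability.Percolation.QuadCrossing

namespace Summit.CriticalPhenomena.CardyFormulaZ2.Cruxes.LagHandOff.HittingTournament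

namespace KernelQuadExclusion

/-- A point of the drawn open edges lies on a unit lattice segment `[δu, δ(u + eᵢ)]` of an open
edge `{u, u + eᵢ} ∈ ω` (orient the edge from its lower-left endpoint). [folklore] -/
theorem exists_single_of_mem_openEdgeUnion {δ : ℝ} {ω : BondConfig (Site 2)} {z : ℂ}
    (hz : z ∈ openEdgeUnion δ ω) :
    ∃ (u : Site 2) (i : Fin 2), s(u, u + Pi.single i 1) ∈ ω ∧
      z ∈ segment ℝ (meshPoint δ u) (meshPoint δ (u + Pi.single i 1)) := by
  obtain ⟨x, y, hxy, hω, hz⟩ := mem_openEdgeUnion_iff.1 hz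
  obtain ⟨i, h | h⟩ := (zdGraph_adj_iff x y).1 hxy
  · subst h
    exact ⟨x, i, hω, hz⟩
  · subst h
    refine ⟨y, i, ?_, ?_⟩
    · rwa [Sym2.eq_swap]
    · rwa [segment_symm]

/-- Coordinates of a point of the unit lattice segment `[δu, δ(u + eᵢ)]`: it is
`δ(u + t eᵢ)` for some `t ∈ [0, 1]`. [folklore] -/
theorem exists_re_im_of_mem_segment {δ : ℝ} {u : Site 2} {i : Fin 2} {z : ℂ}
    (hz : z ∈ segment ℝ (meshPoint δ u) (meshPoint δ (u + Pi.single i 1))) :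
    ∃ t : ℝ, 0 ≤ t ∧ t ≤ 1 ∧ z.re = δ * (u 0 + t * (Pi.single i 1 : Site 2) 0) ∧
      z.im = δ * (u 1 + t * (Pi.single i 1 : Site 2) 1) := by
  rw [segment_eq_image'] at hz
  obtain ⟨t, ⟨ht0, ht1⟩, rfl⟩ := hz
  refine ⟨t, ht0, ht1, ?_, ?_⟩
  · simp only [Complex.add_re, Complex.smul_re, Complex.sub_re, meshPoint_re, Pi.add_apply,
      Int.cast_add, smul_eq_mul]
    ring
  · simp only [Complex.add_im, Complex.smul_im, Complex.sub_im, meshPoint_im, Pi.add_apply,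
      Int.cast_add, smul_eq_mul]
    ring

/-- Real part of the dual shift `w + δ(1+i)/2`. [folklore] -/
theorem re_add_shift (δ : ℝ) (w : ℂ) : (w + (δ : ℂ) * (1 + Complex.I) / 2).re = w.re + δ / 2 := by
  simp [Complex.add_re, Complex.div_ofNat_re, Complex.mul_re]

/-- Imaginary part of the dual shift `w + δ(1+i)/2`. [folklore] -/
theorem im_add_shift (δ : ℝ) (w : ℂ) : (w + (δ : ℂ) * (1 + Complex.I) / 2).im = w.im + δ / 2 := by
  simp [Complex.add_im, Complex.div_ofNat_im, Complex.mul_im]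

/-- An integer is not a half-integer: `(m : ℝ) ≠ n + 1/2`. [folklore] -/
theorem int_cast_ne_add_half (m n : ℤ) : (m : ℝ) ≠ n + 2⁻¹ := by
  intro h
  have h1 : ((2 * (m - n) : ℤ) : ℝ) = 1 := by push_cast; linarith
  have h2 : 2 * (m - n) = 1 := by exact_mod_cast h1
  omega

/-- **The drawn open primal edges and the drawn open dual edges are disjoint** (`δ > 0`).  If `z`
lies on a drawn open edge of `ω` and `w` on a drawn open edge of the dual configuration
`dualConfig ω` (dual vertices indexed by lower-left corners of faces), then the true dual point
`w + δ(1+i)/2` is not `z`: parallel primal/dual segments lie on lines at integer versus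
half-integer levels, and perpendicular ones meet only when the dual edge is exactly the dual of the
primal edge (`dualEdge_horizontal`, `dualEdge_vertical`), which `dualConfig` closes
(Grimmett 1999, §11.2). [folklore] -/
theorem shift_ne_of_mem_openEdgeUnion {δ : ℝ} (hδ : 0 < δ) {ω : BondConfig (Site 2)} {z w : ℂ}
    (hz : z ∈ openEdgeUnion δ ω) (hw : w ∈ openEdgeUnion δ (dualConfig ω)) :
    w + (δ : ℂ) * (1 + Complex.I) / 2 ≠ z := by
  intro heq
  obtain ⟨u, i, hu, hzu⟩ := exists_single_of_mem_openEdgeUnion hz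
  obtain ⟨f, j, hf, hwf⟩ := exists_single_of_mem_openEdgeUnion hw
  have hne : dualEdge s(u, u + Pi.single i 1) ≠ s(f, f + Pi.single j 1) :=
    (mem_dualConfig_iff.1 hf).2 _ hu
  obtain ⟨t, ht0, ht1, hzre, hzim⟩ := exists_re_im_of_mem_segment hzu
  obtain ⟨s, hs0, hs1, hwre, hwim⟩ := exists_re_im_of_mem_segment hwf
  have hre : z.re = w.re + δ / 2 := by rw [← heq, re_add_shift]
  have him : z.im = w.im + δ / 2 := by rw [← heq, im_add_shift]
  rw [hzre, hwre] at hre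
  rw [hzim, hwim] at him
  have hre' : (u 0 : ℝ) + t * (Pi.single i 1 : Site 2) 0 =
      f 0 + s * (Pi.single j 1 : Site 2) 0 + 1 / 2 :=
    mul_left_cancel₀ hδ.ne' (by rw [hre]; ring)
  have him' : (u 1 : ℝ) + t * (Pi.single i 1 : Site 2) 1 =
      f 1 + s * (Pi.single j 1 : Site 2) 1 + 1 / 2 :=
    mul_left_cancel₀ hδ.ne' (by rw [him]; ring)
  fin_cases i <;> fin_cases j
  · -- primal horizontal, dual horizontal: `u 1 = f 1 + 1/2`
    simp at him'
    exact int_cast_ne_add_half _ _ him'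
  · -- primal horizontal `{u, u + e₀}`, dual vertical `{f, f + e₁}`: `f = u - e₁`
    simp at hre' him'
    have h1 : ((f 0 - u 0 : ℤ) : ℝ) < 1 := by push_cast; linarith
    have h2 : (-1 : ℝ) < ((f 0 - u 0 : ℤ) : ℝ) := by push_cast; linarith
    have h3 : ((u 1 - f 1 : ℤ) : ℝ) < 2 := by push_cast; linarith
    have h4 : (0 : ℝ) < ((u 1 - f 1 : ℤ) : ℝ) := by push_cast; linarith
    have h1' : f 0 - u 0 < 1 := by exact_mod_cast h1
    have h2' : -1 < f 0 - u 0 := by exact_mod_cast h2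
    have h3' : u 1 - f 1 < 2 := by exact_mod_cast h3
    have h4' : 0 < u 1 - f 1 := by exact_mod_cast h4
    have hfu : f = u - Pi.single 1 1 := by
      funext k
      fin_cases k <;> simp <;> omega
    apply hne
    simp only [Fin.zero_eta, Fin.mk_one]
    rw [dualEdge_horizontal, hfu, sub_add_cancel]
  · -- primal vertical `{u, u + e₁}`, dual horizontal `{f, f + e₀}`: `f = u - e₀`
    simp at hre' him'
    have h1 : ((f 1 - u 1 : ℤ) : ℝ) < 1 := by push_cast; linarith
    have h2 : (-1 : ℝ) < ((f 1 - u 1 : ℤ) : ℝ) := by push_cast; linarith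
    have h3 : ((u 0 - f 0 : ℤ) : ℝ) < 2 := by push_cast; linarith
    have h4 : (0 : ℝ) < ((u 0 - f 0 : ℤ) : ℝ) := by push_cast; linarith
    have h1' : f 1 - u 1 < 1 := by exact_mod_cast h1
    have h2' : -1 < f 1 - u 1 := by exact_mod_cast h2
    have h3' : u 0 - f 0 < 2 := by exact_mod_cast h3
    have h4' : 0 < u 0 - f 0 := by exact_mod_cast h4
    have hfu : f = u - Pi.single 0 1 := by
      funext k
      fin_cases k <;> simp <;> omega
    apply hne
    simp only [Fin.zero_eta, Fin.mk_one]
    rw [dualEdge_vertical, hfu, sub_add_cancel]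
  · -- primal vertical, dual vertical: `u 0 = f 0 + 1/2`
    simp at hre'
    exact int_cast_ne_add_half _ _ hre'

end KernelQuadExclusion

open KernelQuadExclusion in
/-- **Stub `stub_kernel_quadCrossingExclusion` (M3: an open longitudinal crossing excludes a closed
dual transversal path in the same quad).**  For a quad `Q`, a mesh `δ > 0` and a bond configuration
`ω ⊆ E(ℤ²)`: if some crossing `K` of `Q` (compact, connected, in `[Q]`, meeting `∂₀Q` and `∂₂Q`)
lies in the drawn open edges `openEdgeUnion δ ω`, then no path `γ` from `∂₁Q` to `∂₃Q` inside `[Q]`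
lies in the true drawing `openEdgeUnion δ (dualConfig ω) + δ(1+i)/2` of the open dual edges.  The
crossing lemma `Quad.exists_mem_of_isPreconnected_crossing` gives a common point of `K` and `γ`,
and the drawn primal and (shifted) dual open edges are disjoint
(`KernelQuadExclusion.shift_ne_of_mem_openEdgeUnion`) (Schramm–Smirnov 2011, proof of Lemma 6.1;
Grimmett 1999, §11.2). [folklore] -/
theorem stub_kernel_quadCrossingExclusion :
    ∀ (Q : Quad (Set.univ : Set ℂ)) (δ : ℝ) (ω : BondConfig (Site 2)), 0 < δ →
      ω ⊆ (zdGraph 2).edgeSet → (∃ K, Q.IsCrossing K ∧ K ⊆ openEdgeUnion δ ω) →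
      ¬ ∃ (a b : ℂ) (γ : Path a b), a ∈ Q.side 1 ∧ b ∈ Q.side 3 ∧ Set.range γ ⊆ Q.carrier ∧
          Set.range γ ⊆ (fun z : ℂ => z + (δ : ℂ) * (1 + Complex.I) / 2) ''
            openEdgeUnion δ (dualConfig ω) := by
  intro Q δ ω hδ _hω
  rintro ⟨K, ⟨hKc, hKconn, hKsub, hK0, hK2⟩, hKO⟩ ⟨a, b, γ, ha, hb, hγQ, hγD⟩
  have hmem : ∀ t : ℝ, γ.extend t ∈ Set.range γ := fun t => by
    rw [← γ.extend_range]
    exact Set.mem_range_self t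
  obtain ⟨t, -, htK⟩ := Q.exists_mem_of_isPreconnected_crossing hKc hKconn.isPreconnected hKsub
    hK0 hK2 (β := γ.extend) γ.continuous_extend.continuousOn (fun t _ => hγQ (hmem t))
    (by rw [γ.extend_zero]; exact ha) (by rw [γ.extend_one]; exact hb)
  obtain ⟨w, hw, hwt⟩ := hγD (hmem t)
  exact shift_ne_of_mem_openEdgeUnion hδ (hKO htK) hw hwt

end Summit.CriticalPhenomena.CardyFormulaZ2.Cruxes.LagHandOff.HittingTournament

end
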